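import Summits.AtomisticToContinuum.FouriersLaw.Theorems.RobinCoercivity.Negative.Decomposition
import Summits.AtomisticToContinuum.FouriersLaw.Theorems.HonestZwanzigRobinCoercivityPointwise
import Summits.AtomisticToContinuum.FouriersLaw.Theorems.HonestZwanzigRobinCoercivityStubBlockFormAux

/-!
# `HonestZwanzig.RobinCoercivity` — the block memory form on bond ⊕ contact positions (stub `stub_blockForm`)

Support file (`--supports` the crux `RobinCoercivity`, stmt-AtomisticToContinuum-12695, of route `HonestZwanzig`,
sub-problem `FouriersLaw`; stub `stub_blockForm` of line `limit-operator-memory-form`, skeleton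
`Cruxes/RobinCoercivity/Lines/limit_operator_memory_form.lean`). Fixed `N ≥ 2`, every `s > 0`.

Positions `i : Fin (N+1)`: `0` = left contact, `1 … N−1` = bonds `b = i−1`, `N` = right contact. The position
observables are `g_i = Σ_b [b+1 = i] j_b + [i = 0]γ(T − p_0²) + [i = N]γ(T − p_{N−1}²)` (so `g_N` also carries
`j_{N−1} ≡ 0`), the block memory matrix is `W_N(s)_{ij} = γT²·[i = j contact] − schur_s(g_i∘Θ, g_j)`, and the Robin
incidence is `(Bξ)_0 = ξ_0`, `(Bξ)_i = ξ_i − ξ_{i−1}` (`1 ≤ i ≤ N−1`), `(Bξ)_N = ξ_{N−1}`. We prove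
(`stub_blockForm`): `W_N(s)` is symmetric (`blockForm_symm`, part 1); `ξᵀCov(e,e)ξ ≥ 0` (`FeshbachIdentities` (iv));
the identity `ξᵀ𝔽_N(s)ξ = s·ξᵀCov(e,e)ξ + (Bξ)ᵀ W_N(s) (Bξ)` (`blockForm_identity`: the landed even/odd decomposition
`…Negative.feshbach_quadratic_decomposition` rewritten on positions through `Σ_i (Bξ)_i g_i = j_ξ + w_ξ`,
`Σ_i (Bξ)_i (g_i∘Θ) = −j_ξ + w_ξ` and bilinearity of the Schur pairing); and `|Bξ|² =` the crux's Robin form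
(`blockForm_robin`, part 1 `…StubBlockFormAux`).
-/

noncomputable section

open MeasureTheory Finset Matrix
open Literature.MathematicalPhysics.KineticTheory.HeatConduction
open Summit.AtomisticToContinuum.FouriersLaw.Theses.HonestZwanzig
open Summit.AtomisticToContinuum.FouriersLaw.Theorems.HonestZwanzig.NetworkReduction
open Summit.AtomisticToContinuum.FouriersLaw.Theorems.RobinCoercivity.Negative

namespace Summit.AtomisticToContinuum.FouriersLaw.Theorems.HonestZwanzig.Robin

/-! ### Fixed `N`, fixed `s`: the gadgets of the route with their defining equations -/

section FixedN

variable {ω₂ lam β γ : ℝ} {N : ℕ} {T : ℝ}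
  {Adm : (PhaseSpace N → ℝ) → Prop}
  {corr : (PhaseSpace N → ℝ) → (PhaseSpace N → ℝ) → ℝ → ℝ}
  {lap : ℝ → (PhaseSpace N → ℝ) → (PhaseSpace N → ℝ) → ℝ}
  {cov : (PhaseSpace N → ℝ) → (PhaseSpace N → ℝ) → ℝ}
  {e : Fin N → PhaseSpace N → ℝ}
  (hAdm : ∀ f, Adm f ↔ (Continuous f ∧ ∃ A : ℝ, ∀ z,
    |f z| ≤ A * Real.exp ((pinnedChain ω₂ lam β γ).hamiltonian N z / (8 * T))))
  (hcorr : ∀ f g t, corr f g t =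
    (∫ z, f z * (∫ y, g y ∂((pinnedChain ω₂ lam β γ).transitionKernel N T T t.toNNReal z))
      ∂(pinnedChain ω₂ lam β γ).gibbsMeasure N T) -
    (∫ z, f z ∂(pinnedChain ω₂ lam β γ).gibbsMeasure N T) *
      (∫ z, g z ∂(pinnedChain ω₂ lam β γ).gibbsMeasure N T))
  (hlap : ∀ s f g, lap s f g = ∫ t in Set.Ioi (0 : ℝ), Real.exp (-(s * t)) * corr f g t)
  (he : ∀ x z, e x z = z.2 x ^ 2 / 2 + (pinnedChain ω₂ lam β γ).U (z.1 x) +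
    ∑ j : Fin N, ((if j.val = x.val + 1 then (pinnedChain ω₂ lam β γ).V (z.1 j - z.1 x) / 2 else 0) +
      (if x.val = j.val + 1 then (pinnedChain ω₂ lam β γ).V (z.1 x - z.1 j) / 2 else 0)))
  (hFI : ∀ f g : PhaseSpace N → ℝ, Adm f → Adm g →
    Integrable f ((pinnedChain ω₂ lam β γ).gibbsMeasure N T) ∧
    (∀ t : ℝ, 0 ≤ t → Integrable (fun z => f z *
      (∫ y, g y ∂((pinnedChain ω₂ lam β γ).transitionKernel N T T t.toNNReal z)))
      ((pinnedChain ω₂ lam β γ).gibbsMeasure N T)) ∧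
    IntegrableOn (corr f g) (Set.Ioi 0) ∧
    (∀ t : ℝ, 0 ≤ t → corr f g t = corr (fun z => g (z.1, -z.2)) (fun z => f (z.1, -z.2)) t) ∧
    (∀ s : ℝ, 0 < s → ∀ x : Fin N,
      s * lap s (e x) g - cov (e x) g =
        lap s (fun z => (pinnedChain ω₂ lam β γ).generator N T T (e x) (z.1, -z.2)) g ∧
      s * lap s f (e x) - cov f (e x) = lap s f ((pinnedChain ω₂ lam β γ).generator N T T (e x))))
  (hGSE : ∀ (x : Fin N) (z : PhaseSpace N), (pinnedChain ω₂ lam β γ).generator N T T (e x) z =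
    (∑ b : Fin N, ((if x.val = b.val + 1 then (pinnedChain ω₂ lam β γ).bondCurrent N b z else 0) -
      (if b = x then (pinnedChain ω₂ lam β γ).bondCurrent N b z else 0))) +
    (if x.val = 0 then (pinnedChain ω₂ lam β γ).γ * (T - z.2 x ^ 2) else 0) +
    (if x.val = N - 1 then (pinnedChain ω₂ lam β γ).γ * (T - z.2 x ^ 2) else 0))
  (hPS : ∀ x y : Fin N, cov (e x) ((pinnedChain ω₂ lam β γ).generator N T T (e y)) =
    -(if x = y ∧ (x.val = 0 ∨ x.val = N - 1) then (pinnedChain ω₂ lam β γ).γ * T ^ 2 else 0))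
  (hω : 0 < ω₂) (hl : 0 ≤ lam) (hβ : 0 ≤ β) (hT : 0 < T)
  (g : Fin (N + 1) → PhaseSpace N → ℝ)
  (hg : ∀ i z, g i z = (∑ b : Fin N, if b.val + 1 = i.val then (pinnedChain ω₂ lam β γ).bondCurrent N b z else 0) +
    (∑ x : Fin N, if (i.val = 0 ∧ x.val = 0) ∨ (i.val = N ∧ x.val + 1 = N) then
      (pinnedChain ω₂ lam β γ).γ * (T - z.2 x ^ 2) else 0))

include hAdm hcorr hlap he hFI hGSE hPS hω hl hβ hT hg in
/-- **The block memory form of the Feshbach quadratic form** (fixed `N ≥ 2`, `s > 0`):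
`ξᵀ𝔽_N(s)ξ = s·ξᵀCov(e,e)ξ + Σ_i Σ_j (Bξ)_i W_N(s)_{ij} (Bξ)_j` — the even/odd decomposition
`feshbach_quadratic_decomposition` on positions, through `Σ_i (Bξ)_i g_i = j_ξ + w_ξ`,
`Σ_i (Bξ)_i (g_i∘Θ) = −j_ξ + w_ξ`, bilinearity of the Schur pairing and `schur_s(j_ξ, w_ξ) = −schur_s(w_ξ, j_ξ)`. -/
theorem blockForm_identity (hN : 2 ≤ N) {s : ℝ} (hs : 0 < s)
    (G : Matrix (Fin N) (Fin N) ℝ) (hG : ∀ x y, G x y = lap s (e x) (e y))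
    (schur : (PhaseSpace N → ℝ) → (PhaseSpace N → ℝ) → ℝ)
    (hschur : ∀ f g, schur f g = lap s f g - ∑ u, ∑ v, lap s f (e u) * G⁻¹ u v * lap s (e v) g)
    (F : Fin N → Fin N → ℝ)
    (hF : ∀ x y, F x y = s * cov (e x) (e y) - cov (e x) ((pinnedChain ω₂ lam β γ).generator N T T (e y)) -
      schur (fun z => (pinnedChain ω₂ lam β γ).generator N T T (e x) (z.1, -z.2))
        ((pinnedChain ω₂ lam β γ).generator N T T (e y)))
    (W : Fin (N + 1) → Fin (N + 1) → ℝ)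
    (hW : ∀ i j, W i j = (if i = j ∧ (i.val = 0 ∨ i.val = N) then (pinnedChain ω₂ lam β γ).γ * T ^ 2 else 0) -
      schur (fun z => g i (z.1, -z.2)) (g j))
    (Bv : (Fin N → ℝ) → Fin (N + 1) → ℝ)
    (hBv : ∀ ξ i, Bv ξ i = if i.val = N then (∑ x : Fin N, if x.val + 1 = N then ξ x else 0)
      else ∑ x : Fin N, ((if x.val = i.val then ξ x else 0) - (if x.val + 1 = i.val then ξ x else 0)))
    (ξ : Fin N → ℝ) :
    ∑ x, ∑ y, ξ x * F x y * ξ y =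
      s * (∑ x, ∑ y, ξ x * cov (e x) (e y) * ξ y) + ∑ i, ∑ j, Bv ξ i * W i j * Bv ξ j := by
  have hN1 : 1 ≤ N := by omega
  -- the odd and the even observable of the decomposition
  obtain ⟨jξ, hj⟩ : ∃ jξ : PhaseSpace N → ℝ, ∀ z, jξ z = ∑ x, ξ x * ∑ b : Fin N,
      ((if x.val = b.val + 1 then (pinnedChain ω₂ lam β γ).bondCurrent N b z else 0) -
        (if b = x then (pinnedChain ω₂ lam β γ).bondCurrent N b z else 0)) := ⟨_, fun z => rfl⟩
  obtain ⟨wξ, hw⟩ : ∃ wξ : PhaseSpace N → ℝ, ∀ z, wξ z = ∑ x, ξ x *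
      ((if x.val = 0 then (pinnedChain ω₂ lam β γ).γ * (T - z.2 x ^ 2) else 0) +
        (if x.val = N - 1 then (pinnedChain ω₂ lam β γ).γ * (T - z.2 x ^ 2) else 0)) := ⟨_, fun z => rfl⟩
  rw [feshbach_quadratic_decomposition hAdm hcorr hlap he hFI hGSE hPS hω hl hβ hT hN hs G hG schur hschur F hF
    ξ jξ wξ hj hw]
  -- admissibility and parity of `j_ξ`, `w_ξ`, `g_i`
  have hjadm : Adm jξ := by
    refine adm_of_eq Adm hj (adm_sum Adm hAdm Finset.univ _ (adm_const Adm hAdm hω hl hβ hT 0) fun x _ => ?_)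
    refine adm_const_mul Adm hAdm _ (adm_sum Adm hAdm Finset.univ _ (adm_const Adm hAdm hω hl hβ hT 0) fun b _ => ?_)
    exact adm_sub Adm hAdm
      (adm_ite Adm _ (adm_bondCurrent Adm hAdm hω hl hβ hT b) (adm_const Adm hAdm hω hl hβ hT 0))
      (adm_ite Adm _ (adm_bondCurrent Adm hAdm hω hl hβ hT b) (adm_const Adm hAdm hω hl hβ hT 0))
  have hwadm : Adm wξ := by
    refine adm_of_eq Adm hw (adm_sum Adm hAdm Finset.univ _ (adm_const Adm hAdm hω hl hβ hT 0) fun x _ => ?_)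
    refine adm_const_mul Adm hAdm _ (adm_add Adm hAdm ?_ ?_)
    · exact adm_ite Adm _ (adm_const_mul Adm hAdm _ (adm_sub Adm hAdm (adm_const Adm hAdm hω hl hβ hT T)
        (adm_psq Adm hAdm hω hl hβ hT x))) (adm_const Adm hAdm hω hl hβ hT 0)
    · exact adm_ite Adm _ (adm_const_mul Adm hAdm _ (adm_sub Adm hAdm (adm_const Adm hAdm hω hl hβ hT T)
        (adm_psq Adm hAdm hω hl hβ hT x))) (adm_const Adm hAdm hω hl hβ hT 0)
  have hjodd : ∀ z, jξ (z.1, -z.2) = -jξ z := fun z => by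
    rw [hj, hj, ← Finset.sum_neg_distrib]
    refine Finset.sum_congr rfl fun x _ => ?_
    rw [← mul_neg, ← Finset.sum_neg_distrib]
    congr 1
    refine Finset.sum_congr rfl fun b _ => ?_
    simp only [OscillatorChain.bondCurrent_neg_momentum]
    split_ifs <;> ring
  have hweven : ∀ z, wξ (z.1, -z.2) = wξ z := fun z => by
    rw [hw, hw]
    simp only [Pi.neg_apply, neg_sq]
  have hgadm : ∀ i, Adm (g i) := fun i => blockForm_adm_g hAdm hω hl hβ hT g hg i
  -- the weighted position observables in incidence form
  have hA : ∀ z, ∑ i, Bv ξ i * g i z = jξ z + wξ z := fun z => by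
    have h1 : ∀ i, Bv ξ i * g i z =
        Bv ξ i * (∑ b : Fin N, if b.val + 1 = i.val then (pinnedChain ω₂ lam β γ).bondCurrent N b z else 0) +
        Bv ξ i * (∑ x : Fin N, if (i.val = 0 ∧ x.val = 0) ∨ (i.val = N ∧ x.val + 1 = N) then
          (pinnedChain ω₂ lam β γ).γ * (T - z.2 x ^ 2) else 0) := fun i => by
      rw [hg]
      ring
    simp only [h1, Finset.sum_add_distrib]
    rw [blockForm_bond_sum Bv hBv ξ (fun b => (pinnedChain ω₂ lam β γ).bondCurrent N b z)
        (fun b hb => bondCurrent_eq_zero_of_last _ b hb z),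
      blockForm_contact_sum Bv hBv hN1 ξ (fun x => (pinnedChain ω₂ lam β γ).γ * (T - z.2 x ^ 2)), hj, hw]
  have hB : ∀ z, ∑ i, Bv ξ i * g i (z.1, -z.2) = -jξ z + wξ z := fun z => by
    have h1 : ∀ i, Bv ξ i * g i (z.1, -z.2) =
        -(Bv ξ i * (∑ b : Fin N, if b.val + 1 = i.val then (pinnedChain ω₂ lam β γ).bondCurrent N b z else 0)) +
        Bv ξ i * (∑ x : Fin N, if (i.val = 0 ∧ x.val = 0) ∨ (i.val = N ∧ x.val + 1 = N) then
          (pinnedChain ω₂ lam β γ).γ * (T - z.2 x ^ 2) else 0) := fun i => by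
      rw [blockForm_g_rev g hg]
      ring
    simp only [h1, Finset.sum_add_distrib, Finset.sum_neg_distrib]
    rw [blockForm_bond_sum Bv hBv ξ (fun b => (pinnedChain ω₂ lam β γ).bondCurrent N b z)
        (fun b hb => bondCurrent_eq_zero_of_last _ b hb z),
      blockForm_contact_sum Bv hBv hN1 ξ (fun x => (pinnedChain ω₂ lam β γ).γ * (T - z.2 x ^ 2)), hj, hw]
  -- (1) the Schur block in incidence form
  have hS : ∑ i, ∑ j, Bv ξ i * schur (fun z => g i (z.1, -z.2)) (g j) * Bv ξ j =
      -schur jξ jξ + 2 * schur wξ jξ + schur wξ wξ := by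
    have h1 : ∀ i j, Bv ξ i * schur (fun z => g i (z.1, -z.2)) (g j) * Bv ξ j =
        schur (fun z => Bv ξ i * g i (z.1, -z.2)) (fun z => Bv ξ j * g j z) := fun i j => by
      rw [schur_const_mul_left' hcorr hlap s G schur hschur, schur_const_mul_right' hcorr hlap s G schur hschur]
      ring
    simp only [h1]
    rw [sum_sum_schur_eq_schur_sum hAdm hcorr hlap he hFI hω hl hβ hT hs.le G schur hschur Finset.univ Finset.univ
      (fun i z => Bv ξ i * g i (z.1, -z.2)) (fun j z => Bv ξ j * g j z)
      (fun i _ => adm_const_mul Adm hAdm _ (adm_rev Adm hAdm (hgadm i)))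
      (fun j _ => adm_const_mul Adm hAdm _ (hgadm j))]
    have hfsum : (fun z => ∑ i, Bv ξ i * g i (z.1, -z.2)) = fun z => (-1 : ℝ) * jξ z + wξ z :=
      funext fun z => by rw [hB]; ring
    have hgsum : (fun z => ∑ j, Bv ξ j * g j z) = fun z => jξ z + wξ z := funext hA
    rw [hfsum, hgsum, schur_add_add hAdm hcorr hlap he hFI hω hl hβ hT hs.le G schur hschur
        (adm_const_mul Adm hAdm _ hjadm) hwadm hjadm hwadm,
      schur_const_mul_left' hcorr hlap s G schur hschur, schur_const_mul_left' hcorr hlap s G schur hschur,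
      schur_odd_even hAdm hcorr hlap he hFI hω hl hβ hT G hG schur hschur hjadm hwadm hjodd hweven]
    ring
  -- (2) the static contact block in incidence form
  have h0sq : (∑ i : Fin N, if i.val = 0 then ξ i ^ 2 else 0) = ξ ⟨0, hN1⟩ ^ 2 :=
    sum_ite_eq_of_unique (fun i => ξ i ^ 2) ⟨0, hN1⟩ rfl (fun x hx => Fin.ext hx)
  have hNsq : (∑ i : Fin N, if i.val = N - 1 then ξ i ^ 2 else 0) = ξ ⟨N - 1, by omega⟩ ^ 2 :=
    sum_ite_eq_of_unique (fun i => ξ i ^ 2) ⟨N - 1, by omega⟩ rfl (fun x hx => Fin.ext hx)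
  have hD : ∑ i, ∑ j, Bv ξ i *
      (if i = j ∧ (i.val = 0 ∨ i.val = N) then (pinnedChain ω₂ lam β γ).γ * T ^ 2 else 0) * Bv ξ j =
      (pinnedChain ω₂ lam β γ).γ * T ^ 2 *
        ∑ i : Fin N, ((if i.val = 0 then ξ i ^ 2 else 0) + (if i.val = N - 1 then ξ i ^ 2 else 0)) := by
    have hin : ∀ i : Fin (N + 1), ∑ j, Bv ξ i *
        (if i = j ∧ (i.val = 0 ∨ i.val = N) then (pinnedChain ω₂ lam β γ).γ * T ^ 2 else 0) * Bv ξ j =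
        if (i.val = 0 ∨ i.val = N) then Bv ξ i * ((pinnedChain ω₂ lam β γ).γ * T ^ 2) * Bv ξ i else 0 := by
      intro i
      rw [Finset.sum_eq_single i]
      · by_cases h : i.val = 0 ∨ i.val = N
        · rw [if_pos (show i = i ∧ (i.val = 0 ∨ i.val = N) from ⟨rfl, h⟩), if_pos h]
        · rw [if_neg (show ¬(i = i ∧ (i.val = 0 ∨ i.val = N)) from fun h' => h h'.2), if_neg h]
          ring
      · intro j _ hji
        rw [if_neg (show ¬(i = j ∧ (i.val = 0 ∨ i.val = N)) from fun h' => hji h'.1.symm)]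
        ring
      · intro h
        exact absurd (Finset.mem_univ i) h
    simp only [hin]
    rw [Fintype.sum_eq_add (0 : Fin (N + 1)) (Fin.last N) (zero_ne_last hN1)]
    · rw [if_pos (Or.inl (Fin.val_zero (N + 1))), if_pos (Or.inr (Fin.val_last N)), blockForm_Bv_zero Bv hBv hN1,
        blockForm_Bv_last Bv hBv hN1, Finset.sum_add_distrib, h0sq, hNsq]
      ring
    · rintro i ⟨hi0, hiN⟩
      refine if_neg ?_
      rintro (h | h)
      · exact hi0 (Fin.ext (by rw [h, Fin.val_zero]))
      · exact hiN (Fin.ext (by rw [h, Fin.val_last]))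
  -- assemble
  have hsplit : ∑ i, ∑ j, Bv ξ i * W i j * Bv ξ j =
      (∑ i, ∑ j, Bv ξ i *
        (if i = j ∧ (i.val = 0 ∨ i.val = N) then (pinnedChain ω₂ lam β γ).γ * T ^ 2 else 0) * Bv ξ j) -
      ∑ i, ∑ j, Bv ξ i * schur (fun z => g i (z.1, -z.2)) (g j) * Bv ξ j := by
    simp only [hW, mul_sub, sub_mul, Finset.sum_sub_distrib]
  rw [hsplit, hD, hS]
  ring

end FixedN

/-! ### The stub -/

/-- **Stub `stub_blockForm` of line `limit-operator-memory-form`, crux `RobinCoercivity`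
(stmt-AtomisticToContinuum-12695): THE BLOCK MEMORY FORM ON BOND ⊕ CONTACT SPACE** (fixed `N ≥ 2`, every `s > 0`).
Gadgets `lap, cov, e, G, schur, F` are the route decl's own (with their defining equations); `g_i`
(`i : Fin (N+1)` a position) `= Σ_b [b+1 = i] j_b + [i = 0]γ(T − p_0²) + [i = N]γ(T − p_{N−1}²)`; the block memory
matrix `W_N(s)_{ij} = γT²·[i = j ∧ i contact] − schur_s(g_i∘Θ, g_j)`; the Robin incidence `(Bξ)_0 = ξ_0`,
`(Bξ)_i = ξ_i − ξ_{i−1}` (`1 ≤ i ≤ N−1`), `(Bξ)_N = ξ_{N−1}`. Claims: `W_N(s)` is symmetric (time reversal);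
`ξᵀCov(e,e)ξ ≥ 0` (`FeshbachIdentities` (iv)); the identity `ξᵀ𝔽_N(s)ξ = s·ξᵀCov(e,e)ξ + (Bξ)ᵀW_N(s)(Bξ)`
(`…Negative.feshbach_quadratic_decomposition` expanded by bilinearity, with `GeneratorSiteEnergy` and
`ParityStatics`); and `|Bξ|²` is the crux's Robin form. -/
theorem stub_blockForm : ∀ ω₂ lam β γ : ℝ, 0 < ω₂ → 0 < lam → 0 < β → 0 < γ → ∀ T : ℝ, 0 < T → ∀ N : ℕ, 2 ≤ N →
    ∀ (lap : ℝ → (PhaseSpace N → ℝ) → (PhaseSpace N → ℝ) → ℝ)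
      (cov : (PhaseSpace N → ℝ) → (PhaseSpace N → ℝ) → ℝ) (e : Fin N → PhaseSpace N → ℝ)
      (G : ℝ → Matrix (Fin N) (Fin N) ℝ) (schur : ℝ → (PhaseSpace N → ℝ) → (PhaseSpace N → ℝ) → ℝ)
      (F : ℝ → Fin N → Fin N → ℝ) (g : Fin (N + 1) → PhaseSpace N → ℝ)
      (W : ℝ → Fin (N + 1) → Fin (N + 1) → ℝ) (Bv : (Fin N → ℝ) → Fin (N + 1) → ℝ),
    (∀ s f₁ f₂, lap s f₁ f₂ = ∫ t in Set.Ioi (0 : ℝ), Real.exp (-(s * t)) *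
      ((∫ z, f₁ z * (∫ y, f₂ y ∂((pinnedChain ω₂ lam β γ).transitionKernel N T T t.toNNReal z))
          ∂(pinnedChain ω₂ lam β γ).gibbsMeasure N T) -
        (∫ z, f₁ z ∂(pinnedChain ω₂ lam β γ).gibbsMeasure N T) *
          (∫ z, f₂ z ∂(pinnedChain ω₂ lam β γ).gibbsMeasure N T))) →
    (∀ f₁ f₂, cov f₁ f₂ = (∫ z, f₁ z * f₂ z ∂(pinnedChain ω₂ lam β γ).gibbsMeasure N T) -
      (∫ z, f₁ z ∂(pinnedChain ω₂ lam β γ).gibbsMeasure N T) *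
        (∫ z, f₂ z ∂(pinnedChain ω₂ lam β γ).gibbsMeasure N T)) →
    (∀ x z, e x z = z.2 x ^ 2 / 2 + (pinnedChain ω₂ lam β γ).U (z.1 x) +
      ∑ j : Fin N, ((if j.val = x.val + 1 then (pinnedChain ω₂ lam β γ).V (z.1 j - z.1 x) / 2 else 0) +
        (if x.val = j.val + 1 then (pinnedChain ω₂ lam β γ).V (z.1 x - z.1 j) / 2 else 0))) →
    (∀ s, G s = Matrix.of fun x y => lap s (e x) (e y)) →
    (∀ s f₁ f₂, schur s f₁ f₂ = lap s f₁ f₂ - ∑ x, ∑ y, lap s f₁ (e x) * (G s)⁻¹ x y * lap s (e y) f₂) →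
    (∀ s x y, F s x y = s * cov (e x) (e y) - cov (e x) ((pinnedChain ω₂ lam β γ).generator N T T (e y)) -
      schur s (fun z => (pinnedChain ω₂ lam β γ).generator N T T (e x) (z.1, -z.2))
        ((pinnedChain ω₂ lam β γ).generator N T T (e y))) →
    (∀ i z, g i z = (∑ b : Fin N, if b.val + 1 = i.val then (pinnedChain ω₂ lam β γ).bondCurrent N b z else 0) +
      (∑ x : Fin N, if (i.val = 0 ∧ x.val = 0) ∨ (i.val = N ∧ x.val + 1 = N) then
        (pinnedChain ω₂ lam β γ).γ * (T - z.2 x ^ 2) else 0)) →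
    (∀ s i j, W s i j = (if i = j ∧ (i.val = 0 ∨ i.val = N) then (pinnedChain ω₂ lam β γ).γ * T ^ 2 else 0) -
      schur s (fun z => g i (z.1, -z.2)) (g j)) →
    (∀ ξ i, Bv ξ i = if i.val = N then (∑ x : Fin N, if x.val + 1 = N then ξ x else 0)
      else ∑ x : Fin N, ((if x.val = i.val then ξ x else 0) - (if x.val + 1 = i.val then ξ x else 0))) →
    ∀ s : ℝ, 0 < s →
      (∀ i j : Fin (N + 1), W s i j = W s j i) ∧
      (∀ ξ : Fin N → ℝ, 0 ≤ ∑ x, ∑ y, ξ x * cov (e x) (e y) * ξ y) ∧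
      (∀ ξ : Fin N → ℝ, ∑ x, ∑ y, ξ x * F s x y * ξ y =
        s * (∑ x, ∑ y, ξ x * cov (e x) (e y) * ξ y) + ∑ i, ∑ j, Bv ξ i * W s i j * Bv ξ j) ∧
      (∀ ξ : Fin N → ℝ, ∑ i, Bv ξ i ^ 2 =
        (∑ i : Fin N, ((∑ j : Fin N, if j.val = i.val + 1 then (ξ j - ξ i) ^ 2 else 0) +
        (if i.val = 0 then ξ i ^ 2 else 0) + (if i.val = N - 1 then ξ i ^ 2 else 0)))) := by
  intro ω₂ lam β γ hω hl hβ hγ T hT N hN lap cov e G schur F g W Bv hlap hcov he hG hschur hF hg hW hBv s hs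
  have hN1 : 1 ≤ N := by omega
  obtain rfl : lap = fun s f₁ f₂ => ∫ t in Set.Ioi (0 : ℝ), Real.exp (-(s * t)) *
      ((∫ z, f₁ z * (∫ y, f₂ y ∂((pinnedChain ω₂ lam β γ).transitionKernel N T T t.toNNReal z))
          ∂(pinnedChain ω₂ lam β γ).gibbsMeasure N T) -
        (∫ z, f₁ z ∂(pinnedChain ω₂ lam β γ).gibbsMeasure N T) *
          (∫ z, f₂ z ∂(pinnedChain ω₂ lam β γ).gibbsMeasure N T)) :=
    funext fun s => funext fun f₁ => funext fun f₂ => hlap s f₁ f₂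
  obtain rfl : cov = fun f₁ f₂ => (∫ z, f₁ z * f₂ z ∂(pinnedChain ω₂ lam β γ).gibbsMeasure N T) -
      (∫ z, f₁ z ∂(pinnedChain ω₂ lam β γ).gibbsMeasure N T) *
        (∫ z, f₂ z ∂(pinnedChain ω₂ lam β γ).gibbsMeasure N T) := funext fun f₁ => funext fun f₂ => hcov f₁ f₂
  obtain rfl : e = fun x z => z.2 x ^ 2 / 2 + (pinnedChain ω₂ lam β γ).U (z.1 x) +
      ∑ j : Fin N, ((if j.val = x.val + 1 then (pinnedChain ω₂ lam β γ).V (z.1 j - z.1 x) / 2 else 0) +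
        (if x.val = j.val + 1 then (pinnedChain ω₂ lam β γ).V (z.1 x - z.1 j) / 2 else 0)) :=
    funext fun x => funext fun z => he x z
  obtain ⟨-, hFI2, hCp, -⟩ := stub_feshbachIdentities ω₂ lam β γ hω hl hβ hγ T hT N hN
  refine ⟨?_, ?_, ?_, fun ξ => blockForm_robin Bv hBv hN1 ξ⟩
  · intro i j
    exact blockForm_symm (ω₂ := ω₂) (lam := lam) (β := β) (γ := γ) (N := N) (T := T)
      (corr := fun f₁ f₂ t => (∫ z, f₁ z * (∫ y, f₂ y ∂((pinnedChain ω₂ lam β γ).transitionKernel N T T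
        t.toNNReal z)) ∂(pinnedChain ω₂ lam β γ).gibbsMeasure N T) -
        (∫ z, f₁ z ∂(pinnedChain ω₂ lam β γ).gibbsMeasure N T) *
          (∫ z, f₂ z ∂(pinnedChain ω₂ lam β γ).gibbsMeasure N T))
      (cov := fun f₁ f₂ => (∫ z, f₁ z * f₂ z ∂(pinnedChain ω₂ lam β γ).gibbsMeasure N T) -
        (∫ z, f₁ z ∂(pinnedChain ω₂ lam β γ).gibbsMeasure N T) *
          (∫ z, f₂ z ∂(pinnedChain ω₂ lam β γ).gibbsMeasure N T))
      (fun f => Iff.rfl) (fun s f₁ f₂ => rfl) (fun x z => rfl) hFI2 hω hl.le hβ.le hT g hg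
      (G s) (fun x y => by rw [hG, Matrix.of_apply]) (schur s) (fun f₁ f₂ => hschur s f₁ f₂)
      (W s) (fun i j => hW s i j) i j
  · intro ξ
    by_cases hξ : ξ = 0
    · subst hξ
      simp only [Pi.zero_apply, zero_mul, Finset.sum_const_zero, le_refl]
    · exact (hCp ξ hξ).le
  · intro ξ
    exact blockForm_identity (ω₂ := ω₂) (lam := lam) (β := β) (γ := γ) (N := N) (T := T)
      (corr := fun f₁ f₂ t => (∫ z, f₁ z * (∫ y, f₂ y ∂((pinnedChain ω₂ lam β γ).transitionKernel N T T
        t.toNNReal z)) ∂(pinnedChain ω₂ lam β γ).gibbsMeasure N T) -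
        (∫ z, f₁ z ∂(pinnedChain ω₂ lam β γ).gibbsMeasure N T) *
          (∫ z, f₂ z ∂(pinnedChain ω₂ lam β γ).gibbsMeasure N T))
      (cov := fun f₁ f₂ => (∫ z, f₁ z * f₂ z ∂(pinnedChain ω₂ lam β γ).gibbsMeasure N T) -
        (∫ z, f₁ z ∂(pinnedChain ω₂ lam β γ).gibbsMeasure N T) *
          (∫ z, f₂ z ∂(pinnedChain ω₂ lam β γ).gibbsMeasure N T))
      (fun f => Iff.rfl) (fun f₁ f₂ t => rfl) (fun s f₁ f₂ => rfl) (fun x z => rfl) hFI2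
      (fun x z => generatorSiteEnergy_proof ω₂ lam β γ N hN T T x z)
      (fun x y => ((parityStatics_proof ω₂ lam β γ hω hl hβ hγ T hT N hN) x).2 y)
      hω hl.le hβ.le hT g hg hN hs (G s) (fun x y => by rw [hG, Matrix.of_apply]) (schur s)
      (fun f₁ f₂ => hschur s f₁ f₂) (F s) (fun x y => hF s x y) (W s) (fun i j => hW s i j) Bv hBv ξ

end Summit.AtomisticToContinuum.FouriersLaw.Theorems.HonestZwanzig.Robin

end
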